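import Literature.AlgebraicGeometry.Morphisms.GlueDataOverBase
import Mathlib.AlgebraicGeometry.Morphisms.Separated
import HarnessLib

/-!
# Separatedness of a glued scheme: the overlaps must be CLOSED in the products of the charts

[GortzWedhorn2020, Section (9.3) Def. 9.7, Prop. 9.15 (proof)] / [StacksProject, Tag 01KP]: a scheme `X = ⋃ Uᵢ` glued from
glue data `(Uᵢ, Uᵢⱼ, φᵢⱼ)` is separated (over a base `B`) iff every «graph of the gluing relation»
`(incl, φⱼᵢ ∘ incl) : Uᵢⱼ → Uᵢ ×_B Uⱼ` is a CLOSED immersion — because the diagonal of `X → B`, pulled back to the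
open cover `(Uᵢ ×_B Uⱼ)` of `X ×_B X`, is `Uᵢ ∩ Uⱼ = Uᵢⱼ → Uᵢ ×_B Uⱼ`, and being a closed immersion is local on the
target.  THIS FILE proves it for Mathlib's `Scheme.GlueData` (cocycle form) and the glued structure morphism
`q : D.glued ⟶ B` of ★ `Morphisms/GlueDataOverBase` (`ι i ≫ q = p i`):

* `glueData_isSeparated_desc` — if for all `i j` the morphism
  `pullback.lift (D.f i j) (D.t i j ≫ D.f j i) _ : D.V (i, j) ⟶ D.U i ×_B D.U j` is a closed immersion, then
  `IsSeparated q`;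
* `glueData_isClosedImmersion_lift_of_isSeparated` — the converse;
* `glueData_isSeparated_of_forall` — the absolute form (`B` the terminal scheme): `D.glued.IsSeparated`.

Mathlib-only beyond FILE 1 (`Scheme.Pullback.openCoverOfLeftRight`, `pullback_map_diagonal_isPullback`,
`Scheme.GlueData.vPullbackConeIsLimit`, `IsZariskiLocalAtTarget`).  Theorems only; no named fact, no `sorry`.
Cell hodgecm-mathlib, F-DAG hand (h7) «Zariski gluing of `S`-objects from a cocycle», FILE 7; consumer leaf F-8 (8d)
«SEPARATEDNESS of `A⁰` ⇐ the graph of the gluing relation is closed» (price sheet §3 F-8).  HC_CM is proved only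
modulo the printed citations until rung 0 closes; this file discharges none of them.

## References
* [GortzWedhorn2020] U. Görtz, T. Wedhorn, *Algebraic Geometry I*, 2nd ed. (2020), Section (3.5) Prop. 3.10 (gluing),
  Section (9.3) Def. 9.7 (separated: the diagonal is a closed immersion), Prop. 9.15 and its proof
  («`Δ⁻¹(U ×_S V) = U ∩ V`; being a closed immersion is local on the target; `X ×_S X = ⋃ Uᵢ ×_S Uⱼ`»).
* [StacksProject] The Stacks Project, Tag 01JA (Glueing schemes), Tag 01KP (separatedness via a covering).
-/

noncomputable section

universe u

open CategoryTheory CategoryTheory.Limits AlgebraicGeometry TopologicalSpace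

namespace Literature.AlgebraicGeometry.Morphisms

variable (D : Scheme.GlueData.{u}) {B : Scheme.{u}}

/-- The overlap `V (i, j)` is the fibre product of the charts `U i`, `U j` over the glued scheme
(Mathlib `Scheme.GlueData.vPullbackConeIsLimit`, as an `IsPullback` square). [cite: GortzWedhorn2020, Section (3.5) Proposition 3.10]
[cite: StacksProject, Tag 01JA] -/
theorem glueData_isPullback_V (i j : D.J) : IsPullback (D.f i j) (D.t i j ≫ D.f j i) (D.ι i) (D.ι j) :=
  IsPullback.of_isLimit (D.vPullbackConeIsLimit i j)

/-- **The diagonal of the glued scheme over the chart products**: the base change of the diagonal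
`Δ : D.glued → D.glued ×_B D.glued` along the open immersion `U i ×_B U j → D.glued ×_B D.glued` is — up to the
canonical isomorphisms `V (i, j) ≅ U i ×_{D.glued} U j` and `U i ×_B U j ≅ U i ×_{q} U j` — the «graph of the gluing
relation» `(f i j, t i j ≫ f j i) : V (i, j) → U i ×_B U j`: precisely, that graph composed with these isomorphisms is
the comparison map `U i ×_{D.glued} U j → U i ×_B U j` (Mathlib `pullback_map_diagonal_isPullback`).
[cite: GortzWedhorn2020, Section (9.3) Definition 9.7] [cite: StacksProject, Tag 01KP] -/
theorem glueData_map_eq_lift (p : ∀ i, D.U i ⟶ B) (hp : ∀ i j, D.f i j ≫ p i = D.t i j ≫ D.f j i ≫ p j)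
    (q : D.glued ⟶ B) (hq : ∀ i, D.ι i ≫ q = p i) (i j : D.J) :
    pullback.map (D.ι i) (D.ι j) (D.ι i ≫ q) (D.ι j ≫ q) (𝟙 _) (𝟙 _) q (Category.id_comp _).symm
        (Category.id_comp _).symm =
      (glueData_isPullback_V D i j).isoPullback.inv ≫
        pullback.lift (D.f i j) (D.t i j ≫ D.f j i) (by rw [hp, Category.assoc]) ≫
          (pullback.congrHom (hq i) (hq j)).inv := by
  apply pullback.hom_ext
  · simp only [Category.assoc, pullback.congrHom_inv, pullback.lift_fst, Category.comp_id,
      IsPullback.isoPullback_inv_fst]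
  · simp only [Category.assoc, pullback.congrHom_inv, pullback.lift_snd, Category.comp_id,
      IsPullback.isoPullback_inv_snd]

/-- **A glued scheme is separated over `B` as soon as the graphs of the gluing relation are closed**
([GortzWedhorn2020] proof of Prop. 9.15; [StacksProject, Tag 01KP]): if every
`(f i j, t i j ≫ f j i) : V (i, j) → U i ×_B U j` is a closed immersion then the glued structure morphism
`q : D.glued → B` (`ι i ≫ q = p i`) is separated — its diagonal is a closed immersion locally on the open cover
`(U i ×_B U j)` of `D.glued ×_B D.glued` (Mathlib `Scheme.Pullback.openCoverOfLeftRight`), where it is the graph.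
[cite: GortzWedhorn2020, Section (9.3) Proposition 9.15 (proof)] [cite: StacksProject, Tag 01KP] -/
theorem glueData_isSeparated_desc (p : ∀ i, D.U i ⟶ B) (hp : ∀ i j, D.f i j ≫ p i = D.t i j ≫ D.f j i ≫ p j)
    (q : D.glued ⟶ B) (hq : ∀ i, D.ι i ≫ q = p i)
    (h : ∀ i j, IsClosedImmersion
      (pullback.lift (D.f i j) (D.t i j ≫ D.f j i) (by rw [hp, Category.assoc]) : D.V (i, j) ⟶ pullback (p i) (p j))) :
    IsSeparated q := by
  constructor
  refine IsZariskiLocalAtTarget.of_openCover (Scheme.Pullback.openCoverOfLeftRight D.openCover D.openCover q q)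
    fun ij => ?_
  obtain ⟨i, j⟩ := ij
  have hc := pullback_map_diagonal_isPullback (D.ι i) (D.ι j) q
  -- the base change of the diagonal to `U i ×_B U j` is the comparison map, up to `hc.isoPullback`
  have e : Scheme.Cover.pullbackHom (Scheme.Pullback.openCoverOfLeftRight D.openCover D.openCover q q)
      (pullback.diagonal q) (i, j) =
        hc.isoPullback.inv ≫ pullback.map (D.ι i) (D.ι j) (D.ι i ≫ q) (D.ι j ≫ q) (𝟙 _) (𝟙 _) q
          (Category.id_comp _).symm (Category.id_comp _).symm := by
    rw [hc.isoPullback_inv_snd]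
    rfl
  have key : IsClosedImmersion (pullback.map (D.ι i) (D.ι j) (D.ι i ≫ q) (D.ι j ≫ q) (𝟙 _) (𝟙 _) q
      (Category.id_comp _).symm (Category.id_comp _).symm) := by
    rw [glueData_map_eq_lift D p hp q hq, MorphismProperty.cancel_left_of_respectsIso (P := @IsClosedImmersion),
      MorphismProperty.cancel_right_of_respectsIso (P := @IsClosedImmersion)]
    exact h i j
  have key' := (MorphismProperty.cancel_left_of_respectsIso (P := @IsClosedImmersion) hc.isoPullback.inv _).mpr key
  rw [e]
  exact key'

/-- **Conversely**, over a separated glued scheme the graphs of the gluing relation are closed immersions (they are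
base changes of the diagonal). [cite: GortzWedhorn2020, Section (9.3) Definition 9.7] [cite: StacksProject, Tag 01KP] -/
theorem glueData_isClosedImmersion_lift_of_isSeparated (p : ∀ i, D.U i ⟶ B)
    (hp : ∀ i j, D.f i j ≫ p i = D.t i j ≫ D.f j i ≫ p j) (q : D.glued ⟶ B) (hq : ∀ i, D.ι i ≫ q = p i)
    [IsSeparated q] (i j : D.J) :
    IsClosedImmersion
      (pullback.lift (D.f i j) (D.t i j ≫ D.f j i) (by rw [hp, Category.assoc]) : D.V (i, j) ⟶ pullback (p i) (p j)) := by
  have hc := pullback_map_diagonal_isPullback (D.ι i) (D.ι j) q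
  have hmap : IsClosedImmersion (pullback.map (D.ι i) (D.ι j) (D.ι i ≫ q) (D.ι j ≫ q) (𝟙 _) (𝟙 _) q
      (Category.id_comp _).symm (Category.id_comp _).symm) :=
    MorphismProperty.of_isPullback hc (IsSeparated.isClosedImmersion_diagonal (f := q))
  rw [glueData_map_eq_lift D p hp q hq, MorphismProperty.cancel_left_of_respectsIso (P := @IsClosedImmersion),
    MorphismProperty.cancel_right_of_respectsIso (P := @IsClosedImmersion)] at hmap
  exact hmap

/-- **Absolute form**: if every `(f i j, t i j ≫ f j i) : V (i, j) → U i × U j` (product over the terminal scheme,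
written as the fibre product of the terminal morphisms) is a closed immersion, the glued scheme is SEPARATED.
[cite: GortzWedhorn2020, Section (9.3) Definition 9.7 and Proposition 9.15 (proof)] [cite: StacksProject, Tag 01KP] -/
theorem glueData_isSeparated_of_forall
    (h : ∀ i j, IsClosedImmersion
      (pullback.lift (D.f i j) (D.t i j ≫ D.f j i) (by simp only [terminal.comp_from]) :
        D.V (i, j) ⟶ pullback (terminal.from (D.U i)) (terminal.from (D.U j)))) :
    D.glued.IsSeparated :=
  ⟨glueData_isSeparated_desc D (fun i => terminal.from (D.U i)) (fun i j => by simp only [terminal.comp_from])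
    (terminal.from D.glued) (fun i => terminal.comp_from _) h⟩

end Literature.AlgebraicGeometry.Morphisms

end
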